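import Summits.QuantumFields.BalabanUV.T4Continuum.Spine.NE1p.DressedRootStrictSeparation
import Summits.QuantumFields.BalabanUV.T4Continuum.Spine.NE1p.DressedRootWitness
import Summits.QuantumFields.BalabanUV.T4Continuum.Spine.NE7.QLaFromNE1p

/-!
# BalabanUVNodes ∕ node N14 = NE1′ — «dressed stability of the observable-attached terms, μ- and K-uniform» BY NAME in the
# route-importable venue: the node statement at ARBITRARY carriers from ONE Prop-level slot, its record shape over an ARBITRARY
# record predicate, what it hands its consumers, and the vacuity ∕ rate-pin guards

Cell `pub-ymgap`, HUMAN RULING D-0062 (Track A at full width), seat `pub-ymgap-dag-n14-a` (-a KNIT-BY-NAME); route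
`Summits/QuantumFields/YangMills/Theses/BalabanUVNodes.lean` (item `SpineGivenEndpoint`, cluster K4 «SpineRates»); venue ruling R424
(the node decls a route imports live under `YangMills/Theorems`, which may import any `Summits` module).  THEOREMS ONLY (no `def`,
no `def … : Prop`); imports the NE1′ owner lineage's `Spine/NE1p/DressedRootStrictSeparation` (through it `DressedRootStrict` p216910 —
ROOT-C OF RECORD — and `DressedRootFam`, `DressedRoot`), `Spine/NE1p/DressedRootWitness`, and for the out-edge of §5 the
pub-balaban-gaps seat ne7's `Spine/NE7/QLaFromNE1p` (→ `Spine.NE7.QLa`, `T4FirstOrderSize`) ONLY; modifies nothing; every cited lemma is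
used BY NAME.

THE NODE.  YM-PLAN v0.12.15 §2c row NE1′ ∕ BALABAN-GAPS v1.0 §C l.46: statement of record
`Summit.QuantumFields.BalabanUV.T4Continuum.NE1p.DressedRoot.DressedStabilityStrict 𝒯 Λ` (`Spine/NE1p/DressedRootStrict.lean` :58) —
K- and μ-free class constants `A₀ ρ₁ τ` and `r < 1` with the STRICT PRODUCT `Λ·ρ₁·τ ≤ r` against the bookings' positional rate `Λ`,
such that at every cutoff `K` and run parameter `p` the booked observable-attached terms of the dressed run lie in the two-rate class
`twoRate A₀ ρ₁ τ K`.  NOT PRINTED ([Balaban1989LargeFieldII] (1.73)–(1.75) pp. 379–380 type the ACTION's representation only; p. 356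
ll. 1–6 defers observables); NOT PROVED; never asserted here.  The D59 route reads it as `YMDAG.UVSplit.N14At c := DressedStabilityStrict
c.𝒯 c.Λ` on carriers `c = ⟨P, 𝒯, Λ⟩` and `S_N14 RRec := ∀ F D g₀ os R, RRec F D g₀ os R → N14At R.ne1` under a record predicate
`RRec` that NODE 00 has not yet defined (Stages ≤ 3 pin no spine carrier) — so NO discharge of N14 is possible today; this module is
the by-name KNIT the stub closes against once the record predicate pins carriers that carry the slot of §1.

* §1 THE SLOT.  `n14_of_uniformLeaves`: at ANY carriers `(P, 𝒯, Λ)`, N14 ⇐ ONE Prop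
  `∃ U : UniformConstants, U.Λ = Λ ∧ ∀ p K, Nonempty (BookingLeaves U (𝒯.B p K) (𝒯.T p K))` — END-B
  `DressedRootStrict.dressedStabilityStrict_of_bookingLeaves` BY NAME (ONE `U` before `∀ p K`: the quantifier order IS the μ-∕K-uniformity).
  The fields of `DressedRoot.BookingLeaves` ARE the wall of record (w1)+(w5b) `hbirth`, T `htr`, (w5) `hreg`, (w7) `hrate`, (w3-book)
  `hS`∕`hcount`, (w2-act) `hs₀` — the -b seat's targets, displayed there verbatim; `n14_of_uniformLeaves_of_rate_le` (a larger uniform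
  rate serves every smaller named rate, `DressedRootStrictSeparation.dressedStabilityStrict_anti`).
* §2 THE RECORD SHAPE.  `n14_at_record`: for ANY index type `ι` (standing for `(F, D, g₀, os, R)`), carrier maps `P 𝒯 Λ` and ANY
  predicate `Rec : ι → Prop` — if every `i` of record carries the slot, then `∀ i, Rec i → DressedStabilityStrict (𝒯 i) (Λ i)`:
  exactly the shape of `S_N14 RRec`, closed over NO unpinned frame (R422).
* §3 WHAT N14 HANDS ITS CONSUMERS.  `sizeBound_of_n14` (the size-bound currency with the cutoff NAMED: `∀ p K, (𝒯.B p K).SizeBound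
  (twoRate A₀ ρ₁ τ K)` with `Λ·ρ₁·τ < 1`), `n14_pinned_gives_budget` (the PINNED PAIR «N14 at `Λ` ∧ positional counts at the same `Λ`»
  gives ROOT-B `DressedRootFam.DressedBudget` for every run weight profile in `[0, w̄]` — owner's `dressedBudget_of_dressedStabilityStrict`).
* §4 GUARDS (referee A1–A6).  `uniformLeaves_inhabited` ∕ `n14_toyTower_pinned`: the slot and the pinned pair are INHABITED on the
  owner's decided toy tower (rate `2`, positive sizes) — END-B exercised end to end in the strict form; `n14_not_for_free`: N14 is NOT
  a tautology of the shape (the owner's doubling tower `growingTower` fails it at its own count rate `1`); `n14_rate_pin`: with the rate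
  un-named (`Λ = 0`, or `∃ Λ`) N14 IS the product-free headline `DressedStability`, which holds on the doubling tower where ROOT-B fails —
  TYPING NOTE for the route writer: the record predicate must pin `NE1pCarriers.Λ` to (a bound ABOVE) the bookings' positional count
  rate (cell faces: `L ^ 4`), else `N14At` degenerates to the headline (RULING R-T66 (ii) of the NE1′ crew, here at node level).
* §5 THE OUT-EDGE N14 → N19 BY NAME.  `unitLattice_of_n14`: N14 read AT THE UNIT LATTICE — ONE amplitude `A₀` and ONE per-level
  rate `ρ := ρ₁τ` with `ρ·Λ < 1` bound every booked term at the final scale by `A₀·ρ^{K−j}`, i.e. row NE1′'s consumer shape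
  `T4FirstOrderSize.SizeShape K (A₀ρ^{K−·}) A₀ 1 ρ` at every cutoff; `qla_of_n14`: hence, for every one-run ledger whose component
  `t`-discrepancies are dominated by (volume) × (the class size of the birth scale) and which obeys the (0.26)-type census
  `T4RecentScale.Multiplicity … Λ K` AT N14's RATE `Λ`, NE7's one-run item `Spine.NE7.QLa … (A₀·1·Cw) (ρ·Λ)` holds WITH THE LETTER
  `a = ρ·Λ < 1` — seat ne7's join `Spine.NE7.qla_of_sizeShape` BY NAME; N14's strict product IS (QL-a)'s load-bearing letter (ne/NE7.md
  §4bis: ONE item, two rows); `hsize_of_n14`: both runs are parameters of ONE tower, so ONE N14 gives route 1's two-run END binder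
  `hsize` of `TermwiseResidualWitness.tBracket_le` (`Spine.NE7.hsize_of_qla`).  The domination binder is row NE7's reading of which terms
  make a component's discrepancy — displayed, not discharged.

HONEST FRAMING.  Kernel bookkeeping BY NAME over hypothesis SHAPES; 0 sorry; nothing of Bałaban's densities is asserted or
instantiated; NE1′ is NOT printed and NOT proved — every headline reads «N14 ⇐ the named slot»; the slot's leaves are displayed
binders discharged by nobody; no carrier of N14 is pinned by NODE 00 ⇒ count-neutral (typed 28∕28; the discharged count does not move).
One finite four-torus at fixed ε; NOT infinite volume, NOT OS on ℝ⁴, NOT a mass gap, NOT Clay.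
-/

noncomputable section

namespace YMDAG.N14

open Finset
open scoped BigOperators
open Literature.MathematicalPhysics.QuantumFieldTheory.Balaban1983to89
open Literature.MathematicalPhysics.QuantumFieldTheory.Balaban1983to89.T4TermFormat
open Summit.QuantumFields.BalabanUV.T4Continuum.NE1p.DressedRoot
open Summit.QuantumFields.BalabanUV.T4Continuum.NE1p.DressedRootStrictSeparation
open Literature.MathematicalPhysics.QuantumFieldTheory.Balaban1983to89.T4FirstOrderSize (SizeShape)
open Literature.MathematicalPhysics.QuantumFieldTheory.Balaban1983to89.T4RecentScale (Multiplicity)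
open Summit.QuantumFields.BalabanUV.T4Continuum.Spine.NE7 (QLa qla_of_sizeShape hsize_of_qla)

/-! ## §1 The slot: ONE `UniformConstants` and per-`(p, K)` leaves give N14 at the named rate -/

/-- **N14 FROM THE SLOT «UNIFORM LEAVES»** [bookkeeping]: at ANY carriers `(P, 𝒯, Λ)`, if ONE `U : UniformConstants` with `U.Λ = Λ`
serves the leaf bundle `BookingLeaves U` of the dressed tower at EVERY run parameter and cutoff, then
`DressedStabilityStrict 𝒯 Λ` — END-B `dressedStabilityStrict_of_bookingLeaves` BY NAME.  The slot is Prop-level (`Nonempty`), so it can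
be a clause of a record predicate. [folklore] -/
theorem n14_of_uniformLeaves {P : Type*} (𝒯 : DressedTower P) (Λ : ℝ)
    (h : ∃ U : UniformConstants, U.Λ = Λ ∧ ∀ p K, Nonempty (BookingLeaves U (𝒯.B p K) (𝒯.T p K))) :
    DressedStabilityStrict 𝒯 Λ := by
  obtain ⟨U, rfl, hL⟩ := h
  exact dressedStabilityStrict_of_bookingLeaves U 𝒯 fun p K => Classical.choice (hL p K)

/-- **… AT ANY SMALLER NAMED RATE** [bookkeeping]: uniform leaves at `U` serve `DressedStabilityStrict 𝒯 Λ` for every `0 ≤ Λ ≤ U.Λ`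
(the root of record is antitone in its rate, `dressedStabilityStrict_anti`). [folklore] -/
theorem n14_of_uniformLeaves_of_rate_le {P : Type*} (𝒯 : DressedTower P) {Λ : ℝ} (U : UniformConstants)
    (hL : ∀ p K, Nonempty (BookingLeaves U (𝒯.B p K) (𝒯.T p K))) (h0 : 0 ≤ Λ) (hle : Λ ≤ U.Λ) :
    DressedStabilityStrict 𝒯 Λ :=
  dressedStabilityStrict_anti (n14_of_uniformLeaves 𝒯 U.Λ ⟨U, rfl, hL⟩) h0 hle

/-! ## §2 The record shape: N14 at every carrier of record, over an ARBITRARY record predicate -/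

/-- **N14 AT THE RECORD (discharge shape)** [bookkeeping]: for any index type `ι` (the route's `(F, D, g₀, os, R)`), carrier maps
`P`, `𝒯`, `Λ` and ANY record predicate `Rec : ι → Prop`: if every index of record carries the slot of §1, then
`∀ i, Rec i → DressedStabilityStrict (𝒯 i) (Λ i)` — the shape of the route's `S_N14 RRec`, with nothing closed over an unpinned frame.
[folklore] -/
theorem n14_at_record {ι : Type*} {P : ι → Type*} (𝒯 : ∀ i, DressedTower (P i)) (Λ : ι → ℝ) (Rec : ι → Prop)
    (hRec : ∀ i, Rec i →
      ∃ U : UniformConstants, U.Λ = Λ i ∧ ∀ p K, Nonempty (BookingLeaves U ((𝒯 i).B p K) ((𝒯 i).T p K))) :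
    ∀ i, Rec i → DressedStabilityStrict (𝒯 i) (Λ i) :=
  fun i hi => n14_of_uniformLeaves (𝒯 i) (Λ i) (hRec i hi)

/-- **N14 AT THE RECORD, ONE `U` FOR THE WHOLE RECORD** [bookkeeping]: if ONE `U : UniformConstants` serves the leaves of EVERY carrier
of record and the record pins every named rate into `[0, U.Λ]`, then N14 holds at every carrier of record. [folklore] -/
theorem n14_at_record_of_one {ι : Type*} {P : ι → Type*} (𝒯 : ∀ i, DressedTower (P i)) (Λ : ι → ℝ) (Rec : ι → Prop)
    (U : UniformConstants) (hL : ∀ i, Rec i → ∀ p K, Nonempty (BookingLeaves U ((𝒯 i).B p K) ((𝒯 i).T p K)))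
    (hΛ : ∀ i, Rec i → 0 ≤ Λ i ∧ Λ i ≤ U.Λ) :
    ∀ i, Rec i → DressedStabilityStrict (𝒯 i) (Λ i) :=
  fun i hi => n14_of_uniformLeaves_of_rate_le (𝒯 i) U (hL i hi) (hΛ i hi).1 (hΛ i hi).2

/-! ## §3 What N14 hands its consumers -/

/-- **N14 IN THE SIZE-BOUND CURRENCY, CUTOFF NAMED** [bookkeeping]: `DressedStabilityStrict 𝒯 Λ` unfolds to class constants
`A₀ ρ₁ τ ≥ 0`, `τ ≤ 1`, `0 ≤ Λ`, the strict product `Λ·ρ₁·τ < 1`, and at every `(p, K)` the booking's `SizeBound` by `twoRate A₀ ρ₁ τ K`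
(the booking's final scale rewritten to the cutoff by `DressedTower.K_eq`) — the currency in which the (2.18)-type consumers read
the class (`DressedRoot.sizeBound_of_dressedStabilityWith`). [folklore] -/
theorem sizeBound_of_n14 {P : Type*} {𝒯 : DressedTower P} {Λ : ℝ} (h : DressedStabilityStrict 𝒯 Λ) :
    ∃ A₀ ρ₁ τ : ℝ, 0 ≤ A₀ ∧ 0 ≤ ρ₁ ∧ 0 ≤ τ ∧ τ ≤ 1 ∧ 0 ≤ Λ ∧ Λ * ρ₁ * τ < 1 ∧
      ∀ p K, (𝒯.B p K).SizeBound (twoRate A₀ ρ₁ τ K) := by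
  obtain ⟨A₀, ρ₁, τ, hW, hΛ, h1⟩ := dressedStabilityStrict_iff_lt_one.mp h
  refine ⟨A₀, ρ₁, τ, hW.1, hW.2.1, hW.2.2.1, hW.2.2.2.1, hΛ, h1, fun p K => ?_⟩
  have hcl := sizeBound_of_dressedStabilityWith hW p K
  rwa [𝒯.K_eq p K] at hcl

/-- **THE PINNED PAIR GIVES ROOT-B** [bookkeeping]: N14 at rate `Λ` TOGETHER WITH K-free positional counts `N₀·Λ^{k−j}` of the same
bookings at the SAME rate (the pair a record predicate must pin — §4 `n14_rate_pin`) gives the budget root `DressedBudget 𝒯 w` for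
every run weight profile with `0 ≤ w ≤ w̄` (owner's `dressedBudget_of_dressedStabilityStrict` BY NAME; constant `w̄·N₀A₀∕(1−r)`).
[folklore] -/
theorem n14_pinned_gives_budget {P : Type*} {𝒯 : DressedTower P} {Λ N₀ wbar : ℝ} {w : P → ℕ → ℕ → ℝ}
    (h : DressedStabilityStrict 𝒯 Λ ∧ ∀ p K, (𝒯.B p K).PositionalCount fun j k => N₀ * Λ ^ (k - j))
    (hN₀ : 0 ≤ N₀) (hwbar : 0 ≤ wbar) (hw0 : ∀ p K, ∀ j ≤ K, 0 ≤ w p K j) (hwb : ∀ p K, ∀ j ≤ K, w p K j ≤ wbar) :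
    DressedBudget 𝒯 w :=
  dressedBudget_of_dressedStabilityStrict h.1 hN₀ hwbar hw0 hwb h.2

/-- **… ALSO WITH THE COUNTS AT ANY DOMINATED RATE** [bookkeeping]: N14 at `Λ` and counts at a rate `Λ₀ ∈ [0, Λ]` give ROOT-B
(`dressedBudget_of_dressedStabilityStrict_of_rate_le`); below the count rate it need not (owner crew's `rate_domination_needed`).
[folklore] -/
theorem n14_gives_budget_of_rate_le {P : Type*} {𝒯 : DressedTower P} {Λ Λ₀ N₀ wbar : ℝ} {w : P → ℕ → ℕ → ℝ}
    (h : DressedStabilityStrict 𝒯 Λ ∧ ∀ p K, (𝒯.B p K).PositionalCount fun j k => N₀ * Λ₀ ^ (k - j))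
    (h0 : 0 ≤ Λ₀) (hle : Λ₀ ≤ Λ) (hN₀ : 0 ≤ N₀) (hwbar : 0 ≤ wbar)
    (hw0 : ∀ p K, ∀ j ≤ K, 0 ≤ w p K j) (hwb : ∀ p K, ∀ j ≤ K, w p K j ≤ wbar) :
    DressedBudget 𝒯 w :=
  dressedBudget_of_dressedStabilityStrict_of_rate_le h.1 hN₀ h0 hle hwbar hw0 hwb h.2

/-! ## §4 Guards: the slot is inhabited, N14 is not a tautology, and the rate must be pinned -/

/-- The owner's decided toy tower has K-free positional counts at rate `2` with multiplicity `1` (one birth felt per cube).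
[folklore] -/
theorem positionalCount_toyTower (p : Unit) (K : ℕ) :
    (toyTower.B p K).PositionalCount fun j k => (1 : ℝ) * (2 : ℝ) ^ (k - j) := by
  intro q j
  show (((toyBooking K).feltOfScale q j).card : ℝ) ≤ 1 * 2 ^ ((toyBooking K).cubeScale q - j)
  have h1 : ((toyBooking K).feltOfScale q j).card ≤ 1 :=
    (Finset.card_filter_le _ _).trans (by simp [toyBooking])
  have h2 : (1 : ℝ) ≤ (2 : ℝ) ^ ((toyBooking K).cubeScale q - j) := one_le_pow₀ (by norm_num)
  calc (((toyBooking K).feltOfScale q j).card : ℝ) ≤ 1 := by exact_mod_cast h1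
    _ ≤ 1 * 2 ^ ((toyBooking K).cubeScale q - j) := by rw [one_mul]; exact h2

/-- **A1: THE SLOT IS INHABITED** [decided toy]: the owner's toy tower carries uniform leaves with ONE `U` (`toyConstants`, rate
`U.Λ = 2`) at every run parameter and cutoff — END-B's hypothesis bundle is not vacuous. [folklore] -/
theorem uniformLeaves_inhabited :
    ∃ U : UniformConstants, U.Λ = 2 ∧ ∀ p K, Nonempty (BookingLeaves U (toyTower.B p K) (toyTower.T p K)) :=
  ⟨toyConstants, rfl, fun _ K => ⟨toyLeaves K⟩⟩

/-- **A2: N14 AND ITS PINNED PAIR ARE INHABITED, NON-DEGENERATELY** [decided toy]: on the toy tower N14 holds at the bookings' own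
count rate `2` (through §1, i.e. through END-B in the strict form), the positional counts hold at that rate, and every booked size
is POSITIVE. [folklore] -/
theorem n14_toyTower_pinned :
    DressedStabilityStrict toyTower 2 ∧
      (∀ p K, (toyTower.B p K).PositionalCount fun j k => (1 : ℝ) * (2 : ℝ) ^ (k - j)) ∧
      ∀ (K k : ℕ) (b : (toyBooking K).Birth), 0 < (toyBooking K).size b k :=
  ⟨n14_of_uniformLeaves toyTower 2 uniformLeaves_inhabited, positionalCount_toyTower, toy_size_pos⟩

/-- … hence ROOT-B on the toy at unit weights, through the node's own budget face (§3 exercised end to end). [folklore] -/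
theorem budget_toyTower : DressedBudget toyTower (fun _ _ _ => (1 : ℝ)) :=
  n14_pinned_gives_budget (N₀ := 1) (wbar := 1) ⟨n14_toyTower_pinned.1, n14_toyTower_pinned.2.1⟩ zero_le_one zero_le_one
    (fun _ _ _ _ => zero_le_one) fun _ _ _ _ => le_rfl

/-- **A3: N14 IS NOT A TAUTOLOGY OF ITS SHAPE** [decided toy]: not every dressed tower has N14 at every nonnegative rate — the
owner's doubling tower `growingTower` (observable-attached terms doubling at every step) fails it at its own count rate `1`
(`not_dressedStabilityStrict_growingTower`), although it HAS the product-free headline (`dressedStability_growingTower`). [folklore] -/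
theorem n14_not_for_free :
    (¬ ∀ (𝒯 : DressedTower Unit) (Λ : ℝ), 0 ≤ Λ → DressedStabilityStrict 𝒯 Λ) ∧
      DressedStability growingTower ∧ ¬ DressedStabilityStrict growingTower 1 :=
  ⟨fun h => not_dressedStabilityStrict_growingTower (h growingTower 1 zero_le_one), dressedStability_growingTower,
    not_dressedStabilityStrict_growingTower⟩

/-- **A4: THE RATE PIN (typing note for the record predicate, in kernel)** [bookkeeping + decided toy]: (i) with the rate un-named —
at `Λ = 0`, or existentially closed — N14 IS the product-free headline `DressedStability` (`dressedStabilityStrict_zero_iff`,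
`exists_dressedStabilityStrict_iff`); (ii) the headline is NOT a sufficient root: the doubling tower has N14 at rate `0`, fails N14 at
its count rate `1`, and has NO budget at unit weights (`not_dressedBudget_growingTower`).  Hence a record predicate for N14's carriers
`⟨P, 𝒯, Λ⟩` must pin `Λ` at or above the positional count rate of `𝒯`'s bookings (cell faces: `L ^ 4`). [folklore] -/
theorem n14_rate_pin :
    (∀ {P : Type} (𝒯 : DressedTower P),
        (DressedStabilityStrict 𝒯 0 ↔ DressedStability 𝒯) ∧ ((∃ Λ, DressedStabilityStrict 𝒯 Λ) ↔ DressedStability 𝒯)) ∧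
      DressedStabilityStrict growingTower 0 ∧ ¬ DressedStabilityStrict growingTower 1 ∧
      ¬ DressedBudget growingTower (fun _ _ _ => (1 : ℝ)) :=
  ⟨fun _ => ⟨dressedStabilityStrict_zero_iff, exists_dressedStabilityStrict_iff⟩,
    dressedStabilityStrict_zero_iff.mpr dressedStability_growingTower, not_dressedStabilityStrict_growingTower,
    not_dressedBudget_growingTower⟩

/-! ## §5 The out-edge N14 → N19 by name: the unit-lattice sizes and NE7's one-run item (QL-a) with its letter `a < 1` -/

/-- **N14 AT THE UNIT LATTICE** [bookkeeping]: `DressedStabilityStrict 𝒯 Λ` gives ONE amplitude `A₀ ≥ 0` and ONE per-level rate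
`ρ := ρ₁·τ ≥ 0` with `ρ·Λ < 1` such that every booked observable-attached term, at the FINAL scale of every cutoff-`K` booking, is
`≤ A₀·ρ^{K−j}` (`j` its birth scale) — the class read at `k = K` — and the profile `j ↦ A₀ρ^{K−j}` has row NE1′'s consumer shape
`SizeShape K · A₀ 1 ρ` (weight `1`). [folklore] -/
theorem unitLattice_of_n14 {P : Type*} {𝒯 : DressedTower P} {Λ : ℝ} (h : DressedStabilityStrict 𝒯 Λ) :
    ∃ A₀ ρ : ℝ, 0 ≤ A₀ ∧ 0 ≤ ρ ∧ 0 ≤ Λ ∧ ρ * Λ < 1 ∧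
      (∀ p K (b : (𝒯.B p K).Birth), (𝒯.B p K).size b K ≤ A₀ * ρ ^ (K - (𝒯.B p K).birthScale b)) ∧
      ∀ K, SizeShape K (fun j => A₀ * ρ ^ (K - j)) A₀ (fun _ => 1) ρ := by
  obtain ⟨A₀, ρ₁, τ, hW, hΛ, h1⟩ := dressedStabilityStrict_iff_lt_one.mp h
  obtain ⟨hA₀, hρ₁, hτ0, _, hcl⟩ := hW
  have hρ : 0 ≤ ρ₁ * τ := mul_nonneg hρ₁ hτ0
  refine ⟨A₀, ρ₁ * τ, hA₀, hρ, hΛ, ?_, ?_, ?_⟩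
  · have e : ρ₁ * τ * Λ = Λ * ρ₁ * τ := by ring
    rw [e]; exact h1
  · intro p K b
    have hK := 𝒯.K_eq p K
    have hb : (𝒯.B p K).birthScale b ≤ (𝒯.B p K).K := (𝒯.B p K).birth_le b
    have hc := hcl p K b (𝒯.B p K).K hb le_rfl
    rw [hK] at hc
    calc (𝒯.B p K).size b K ≤ twoRate A₀ ρ₁ τ K ((𝒯.B p K).birthScale b) K := hc
      _ = A₀ * (ρ₁ * τ) ^ (K - (𝒯.B p K).birthScale b) := by unfold twoRate; rw [mul_pow]; ring
  · intro K j _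
    show |A₀ * (ρ₁ * τ) ^ (K - j)| ≤ A₀ * 1 * (ρ₁ * τ) ^ (K - j)
    rw [abs_of_nonneg (mul_nonneg hA₀ (pow_nonneg hρ _)), mul_one]

/-- **THE OUT-EDGE N14 → N19 (NE7's (QL-a)) BY NAME** [bookkeeping]: from N14 alone, constants `A₀ ρ ≥ 0` with the LETTER `ρ·Λ < 1`
such that for EVERY one-run ledger (`wf`, scales `sc`, volumes `wt ≥ 0`, step constants `ct`∕`c0` at source strength `t`∕`0`) whose
component `t`-discrepancies are dominated by (volume) × (the class size `A₀ρ^{K−j}` of the birth scale) and which obeys the census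
`Multiplicity wf sc wt Cw vol Λ K` at N14's rate `Λ`, NE7's one-run item `QLa wf sc ct c0 K vol (A₀·1·Cw) (ρ·Λ)` holds — seat ne7's
`qla_of_sizeShape` BY NAME on §5's `SizeShape`.  The domination binder is row NE7's reading (displayed, not discharged); the letter
`a = ρ·Λ < 1` the consumer `TermwiseResidualWitness.tBracket_le` needs IS N14's strict product. [folklore] -/
theorem qla_of_n14 {P : Type*} {𝒯 : DressedTower P} {Λ : ℝ} (h : DressedStabilityStrict 𝒯 Λ) :
    ∃ A₀ ρ : ℝ, 0 ≤ A₀ ∧ 0 ≤ ρ ∧ ρ * Λ < 1 ∧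
      ∀ {D : Type} (wf : Finset D) (sc : D → ℕ) (wt ct c0 : D → ℝ) (K : ℕ) (Cw vol : ℝ),
        (∀ X ∈ wf, |ct X - c0 X| ≤ |A₀ * ρ ^ (K - sc X)| * wt X) → (∀ X ∈ wf, 0 ≤ wt X) →
        Multiplicity wf sc wt Cw vol Λ K → QLa wf sc ct c0 K vol (A₀ * 1 * Cw) (ρ * Λ) := by
  obtain ⟨A₀, ρ, hA₀, hρ, -, h1, -, hS⟩ := unitLattice_of_n14 h
  exact ⟨A₀, ρ, hA₀, hρ, h1, fun wf sc wt ct c0 K Cw vol hX hwt hM =>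
    qla_of_sizeShape hX (hS K) (fun _ _ => ⟨zero_le_one, le_rfl⟩) hA₀ hρ hwt hM⟩

/-- **ONE N14, BOTH RUNS: route 1's END binder `hsize`** [bookkeeping]: the two consecutive runs of the spine are two parameters of ONE
dressed tower, so ONE N14 serves both one-run (QL-a) copies with the SAME `(A₀, ρ)`; for any ledger carrying run A's and run B's
step constants, both dominated by the class sizes, and the census at N14's rate, the two-run size binder of
`TermwiseResidualWitness.tBracket_le` holds with `Ew = A₀·1·Cw + A₀·1·Cw` and the letter `a = ρ·Λ < 1` (`hsize_of_qla` BY NAME).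
[folklore] -/
theorem hsize_of_n14 {P : Type*} {𝒯 : DressedTower P} {Λ : ℝ} (h : DressedStabilityStrict 𝒯 Λ) :
    ∃ A₀ ρ : ℝ, 0 ≤ A₀ ∧ 0 ≤ ρ ∧ ρ * Λ < 1 ∧
      ∀ {D : Type} (wf : Finset D) (sc : D → ℕ) (wt cAt cA0 cBt cB0 : D → ℝ) (K : ℕ) (Cw vol : ℝ),
        (∀ X ∈ wf, |cAt X - cA0 X| ≤ |A₀ * ρ ^ (K - sc X)| * wt X) →
        (∀ X ∈ wf, |cBt X - cB0 X| ≤ |A₀ * ρ ^ (K - sc X)| * wt X) → (∀ X ∈ wf, 0 ≤ wt X) →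
        Multiplicity wf sc wt Cw vol Λ K →
        ∀ j ≤ K, ∑ X ∈ wf with sc X = j, (|cAt X - cA0 X| + |cBt X - cB0 X|) ≤
          vol * ((A₀ * 1 * Cw + A₀ * 1 * Cw) * (ρ * Λ) ^ (K - j)) := by
  obtain ⟨A₀, ρ, hA₀, hρ, h1, hQ⟩ := qla_of_n14 h
  exact ⟨A₀, ρ, hA₀, hρ, h1, fun wf sc wt cAt cA0 cBt cB0 K Cw vol hA hB hwt hM =>
    hsize_of_qla (hQ wf sc wt cAt cA0 K Cw vol hA hwt hM) (hQ wf sc wt cBt cB0 K Cw vol hB hwt hM)⟩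

end YMDAG.N14

end
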